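import Summits.BirchSwinnertonDyer.BirchSwinnertonDyer.Theorems.UniversalToricDescentLocalH1DivisibleCurve
import Summits.BirchSwinnertonDyer.BirchSwinnertonDyer.Theorems.UniversalToricDescentSigmaLocalStabilizer
import Summits.BirchSwinnertonDyer.Rank1Residual.X2.GreenbergSelmerCountNonsplit
import HarnessLib

/-!
# Route UniversalToricDescent — Greenberg–Vatsal Prop. (2.4) in the tree's `ℤ_p`-CORANK currency:
# `corank_{ℤ_p} H¹(K_{∞,w}, E[p^∞]) = s_v` (`= d_v`), at a place `v ∤ p` finitely decomposed in a `ℤ_p`-extension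

Lead prover bsd-wall-utd-p1 g11 (`--supports` stmt-BirchSwinnertonDyer-20399 lineage / ♭T 26042: the local terms of
the defect transport). Greenberg–Vatsal state Prop. (2.4) as "`𝓗_v(K_∞) ≅ (ℚ_p/ℤ_p)^{δ}`"; the tree measures such
groups by `Literature.NumberTheory.EllipticCurves.zpCorank` (X2, tp2, the `Sha`/`Selmer` files). This file converts
the landed count + divisibility (`natCard_pTorsion_subgroupH1_kerD_eq_pow_ite` p603143, `exists_nsmul_eq_subgroupH1_kerD`
p607660) into that currency, for `E/K` elliptic, any `ℤ_p`-extension `κ`, `v ∤ p` with `D_v ⊄ ker κ`: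

* `zpCorank_subgroupH1_kerD_eq` — `#H¹(kerD κ v, E[p^∞])[p] = p^s ⟹ corank_{ℤ_p} H¹(kerD κ v, E[p^∞]) = s`
  (`p`-primary + `p`-divisible + finite `p`-torsion: X2's `natCard_torsionBy_eq_pow_zpCorank_of_divisible`);
* **`zpCorank_subgroupH1_kerD_eq_ite`** — **`corank_{ℤ_p} H¹(K_{∞,w}, E[p^∞]) = s_v` in CLOSED FORM** (good:
  `0/1/2` by `p ∣ q_v + 1 − a_v`, `p ∣ q_v − 1`; split multiplicative `[p ∣ 1 − q_v]`; non-split `[p ∣ −1 − q_v]`;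
  additive `0`) — Greenberg–Vatsal's Prop. (2.4) verbatim ("its `λ`-invariant is `s_ℓ d_ℓ`", here per prime of `K_∞`);
* `zpCorank_subgroupH1_kerD_eq_dMultiplicity` — over `ℚ`: `= GreenbergVatsal2000.dMultiplicity E p v` (X2's `d_ℓ`).

THEOREMS ONLY; no definition, no named fact, no `sorry`. BSD is not advanced by this file.
References: [GreenbergVatsal2000] §1 p. 7 ("`𝓗_ℓ(ℚ_∞) ≅ (ℚ_p/ℤ_p)^{δ_E^{(ℓ)}}`"), §2 Prop. (2.4) (arXiv p. 22);
[Greenberg1999] §1 (coranks).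
-/

set_option autoImplicit false
-- `…BirchSwinnertonDyer.BirchSwinnertonDyer.Theorems…` is the problem's mandated namespace (D-0017).
set_option linter.dupNamespace false

noncomputable section

open scoped Classical AddSubgroup

namespace Summit.BirchSwinnertonDyer.BirchSwinnertonDyer.Theorems.UniversalToricDescentLocalH1Divisible

open Function NumberField IsDedekindDomain Field WeierstrassCurve
open Literature.NumberTheory.EllipticCurves Literature.NumberTheory.EllipticCurves.GreenbergSelmer
  Literature.NumberTheory.GaloisRepresentations IsDedekindDomain.HeightOneSpectrum
  Summit.BirchSwinnertonDyer.Rank1Residual.X11b Summit.BirchSwinnertonDyer.Rank1Residual.X11b.Coinv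
  Summit.BirchSwinnertonDyer.Rank1Residual.Iwasawa
  Summit.BirchSwinnertonDyer.BirchSwinnertonDyer.Theorems.UniversalToricDescentSigmaLocalStabilizer
  Summit.BirchSwinnertonDyer.Rank1Residual.X2.GreenbergSelmerCountNonsplit

section Curve

variable {K : Type} [Field K] [NumberField K] (W : WeierstrassCurve K) [W.IsElliptic] {p : ℕ}
  [Fact p.Prime] (κ : ZpExtension K p) {v : HeightOneSpectrum (𝓞 K)}

/-- **`#H¹(kerD κ v, E[p^∞])[p] = p^s ⟹ corank_{ℤ_p} H¹(kerD κ v, E[p^∞]) = s`** at a place `v ∤ p`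
finitely decomposed in the `ℤ_p`-extension `κ`: the group is `p`-primary (`exists_pow_smul_kerD_eq_zero`),
`p`-divisible (`exists_nsmul_eq_subgroupH1_kerD`) with finite `p`-torsion, so `#[p] = p^{corank}`.
[cite: GreenbergVatsal2000, §2 Prop. (2.4) (arXiv p. 22)] [cite: Greenberg1999, §1] -/
theorem zpCorank_subgroupH1_kerD_eq (hpv : (p : 𝓞 K) ∉ v.asIdeal) (hD : ¬ (decomp v ≤ κ.kerSubgroup))
    {s : ℕ}
    (hs : Nat.card {f : Literature.NumberTheory.EllipticCurves.subgroupH1 (kerD κ v)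
        (W.geomPrimaryTorsion p) // p • f = 0} = p ^ s) :
    zpCorank (Literature.NumberTheory.EllipticCurves.subgroupH1 (kerD κ v) (W.geomPrimaryTorsion p)) p =
      s := by
  have hp : p.Prime := Fact.out
  let A : Type := Literature.NumberTheory.EllipticCurves.subgroupH1 (kerD κ v) (W.geomPrimaryTorsion p)
  -- `p`-primary, `p`-divisible, finite `p`-torsion
  have htor : ∀ m : W.geomPrimaryTorsion p, ∃ k : ℕ, p ^ k • m = 0 := fun m ↦ by
    obtain ⟨k, hk⟩ := m.2
    exact ⟨k, Subtype.ext (by rw [AddSubgroupClass.coe_nsmul]; exact hk)⟩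
  have hS : ∀ a : A, ∃ n : ℕ, p ^ n • a = 0 := fun a ↦ exists_pow_smul_kerD_eq_zero κ htor v a
  have hdiv : ∀ a : A, ∃ b : A, p • b = a := exists_nsmul_eq_subgroupH1_kerD W κ hpv hD
  have e : Nat.card (A[(p : ℤ)]) = Nat.card {f : A // p • f = 0} :=
    Nat.card_congr (Equiv.subtypeEquivRight fun a ↦ AddSubgroup.torsionBy.nsmul_iff)
  haveI : Finite (A[(p : ℤ)]) := by
    apply Nat.finite_of_card_ne_zero
    rw [e, hs]
    exact pow_ne_zero s hp.ne_zero
  have h := natCard_torsionBy_eq_pow_zpCorank_of_divisible p hS hdiv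
  rw [e, hs] at h
  exact (Nat.pow_right_injective hp.two_le h).symm

/-- **Greenberg–Vatsal Prop. (2.4) in corank currency, closed form: `corank_{ℤ_p} H¹(K_{∞,w}, E[p^∞]) = s_v`**
for `E/K` (any reduction type at `v`), any `ℤ_p`-extension, `v ∤ p` with `D_v ⊄ ker κ`; `s_v` = the multiplicity
of the Frobenius eigenvalue `q_v` on `E[p]` read off the reduction type (`q_v = #k_v`, `a_v = W.frobeniusTraceAt v`).
[cite: GreenbergVatsal2000, §1 p. 7 and §2 Prop. (2.4) (arXiv p. 22)] -/
theorem zpCorank_subgroupH1_kerD_eq_ite (hpv : (p : 𝓞 K) ∉ v.asIdeal) (hD : ¬ (decomp v ≤ κ.kerSubgroup)) :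
    zpCorank (Literature.NumberTheory.EllipticCurves.subgroupH1 (kerD κ v) (W.geomPrimaryTorsion p)) p =
      (if W.HasGoodReductionAt v then
          (if (p : ℤ) ∣ (Nat.card (IsLocalRing.ResidueField (v.adicCompletionIntegers K)) : ℤ) + 1 -
                W.frobeniusTraceAt v then
            (if (p : ℤ) ∣ (Nat.card (IsLocalRing.ResidueField (v.adicCompletionIntegers K)) : ℤ) - 1
              then 2 else 1)
            else 0)
        else if W.HasSplitMultiplicativeReductionAt v then
          (if (p : ℤ) ∣ 1 - (Nat.card (IsLocalRing.ResidueField (v.adicCompletionIntegers K)) : ℤ)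
            then 1 else 0)
        else if W.HasMultiplicativeReductionAt v then
          (if (p : ℤ) ∣ -1 - (Nat.card (IsLocalRing.ResidueField (v.adicCompletionIntegers K)) : ℤ)
            then 1 else 0)
        else 0) :=
  zpCorank_subgroupH1_kerD_eq W κ hpv hD
    (UniversalToricDescentLocalTermClosedForm.natCard_pTorsion_subgroupH1_kerD_eq_pow_ite W κ hpv hD)

end Curve

section Rat

open Literature.NumberTheory.EllipticCurves.GreenbergVatsal2000

variable (W : WeierstrassCurve ℚ) [W.IsElliptic] {p : ℕ} [hp : Fact p.Prime] (κ : ZpExtension ℚ p)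
  {v : HeightOneSpectrum (𝓞 ℚ)}

/-- **Over `ℚ`: `corank_{ℤ_p} H¹(ℚ_{∞,η}, E[p^∞]) = d_ℓ`** (`GreenbergVatsal2000.dMultiplicity E p v`, the
multiplicity of `ℓ̃⁻¹` as a root of `P̃_ℓ mod p`), for any `ℤ_p`-extension of `ℚ` and `v = (ℓ)`, `ℓ ≠ p`,
finitely decomposed — "`𝓗_ℓ(ℚ_∞) ≅ (ℚ_p/ℤ_p)^{δ_E^{(ℓ)}}`" per prime `η ∣ ℓ` of `ℚ_∞`.
[cite: GreenbergVatsal2000, §1 p. 7 and §2 Prop. (2.4) (arXiv p. 22)] -/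
theorem zpCorank_subgroupH1_kerD_eq_dMultiplicity (hpv : (p : 𝓞 ℚ) ∉ v.asIdeal)
    (hD : ¬ (decomp v ≤ κ.kerSubgroup)) :
    zpCorank (Literature.NumberTheory.EllipticCurves.subgroupH1 (kerD κ v) (W.geomPrimaryTorsion p)) p =
      dMultiplicity W p v :=
  zpCorank_subgroupH1_kerD_eq W κ hpv hD
    (UniversalToricDescentLocalTermClosedForm.natCard_pTorsion_subgroupH1_kerD_eq_pow_dMultiplicity W κ hpv hD)

end Rat

end Summit.BirchSwinnertonDyer.BirchSwinnertonDyer.Theorems.UniversalToricDescentLocalH1Divisible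

end
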